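import Summits.KontsevichZagierPeriods.KontsevichZagierPeriods.Theorems.FiveTermTransfer.Negative.LoadBearing

/-!
# `FiveTermTransfer` (stmt-KontsevichZagierPeriods-3469) — part 6: sign dictionary for the chamber analysis

For the provers of the crux: the sign of `Im` of each argument of the class map `B` in the
five-term element is the sign of a polynomial in `(Re x, Im x, Re y, Im y)` — `Im x`, `Im y`, the
orientation of `(0, x, y)` (`im_arg_three`), minus the orientation of `(1, x, y)` (`im_arg_five`),
and the concyclicity determinant of `(0, 1, x, y)` (`im_arg_four`), with the displayed positive
factors; these are the `4 × 4` minors of the lifted configuration `{∞, 0, 1, x, y}` whose signs are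
the Radon coefficients of the five points on the sphere (numerically the coefficient signs of the
element match them in every one of the 51 sign chambers; see the work file
`Cruxes/FiveTermTransfer/Disproof.lean`, appendix). Also `z₄ = z₃ · z₅` (`arg_four_eq_mul`).
(cdisprove seat gen 2.) [folklore]
-/

noncomputable section

open Complex
open scoped ComplexConjugate

namespace Summit.KontsevichZagierPeriods.HyperbolicBloch.FiveTermTransferNegative

/-! ## §6 Dictionary: the signs of the five arguments are polynomial signs (Radon minors)

For the provers' chamber analysis: `sign Im` of each argument of `B` is the sign of a polynomial in
`(Re x, Im x, Re y, Im y)` — the orientation of `(0, x, y)`, minus the orientation of `(1, x, y)`,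
and the concyclicity determinant of `(0, 1, x, y)` — i.e. (up to the fixed positive factors
displayed) the `4 × 4` minors of the lifted configuration `{∞, 0, 1, x, y}` whose signs are the
Radon coefficients (numerically: census rule of item 3 of the header). Also `z₄ = z₃ · z₅`. -/

/-- `z₄ = z₃ · z₅`: `(1 − x⁻¹)/(1 − y⁻¹) = (y/x) · ((1 − x)/(1 − y))`. [folklore] -/
theorem arg_four_eq_mul {x y : ℂ} (hx : x ≠ 0) (hy : y ≠ 0) (hy1 : y ≠ 1) :
    (1 - x⁻¹) / (1 - y⁻¹) = (y / x) * ((1 - x) / (1 - y)) := by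
  have h1 : (1 : ℂ) - y ≠ 0 := sub_ne_zero.mpr (Ne.symm hy1)
  have h2 : (1 : ℂ) - y⁻¹ ≠ 0 := by
    rw [sub_ne_zero, ne_comm, ne_eq, inv_eq_one]; exact hy1
  field_simp
  ring

/-- `Im (y/x) · |x|² = Re x · Im y − Im x · Re y` (twice the signed area of `(0, x, y)`). [folklore] -/
theorem im_arg_three (x y : ℂ) : (y / x).im * Complex.normSq x = x.re * y.im - x.im * y.re := by
  rcases eq_or_ne x 0 with rfl | hx
  · simp
  have hN : Complex.normSq x ≠ 0 := (Complex.normSq_pos.mpr hx).ne'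
  rw [Complex.div_im]
  field_simp

/-- `Im ((1−x)/(1−y)) · |1−y|² = −((Re x − 1) · Im y − Im x · (Re y − 1))` (minus twice the signed
area of `(1, x, y)`). [folklore] -/
theorem im_arg_five (x y : ℂ) : ((1 - x) / (1 - y)).im * Complex.normSq (1 - y) =
    -((x.re - 1) * y.im - x.im * (y.re - 1)) := by
  rcases eq_or_ne y 1 with rfl | hy
  · simp
  have hN : Complex.normSq (1 - y) ≠ 0 :=
    (Complex.normSq_pos.mpr (sub_ne_zero.mpr (Ne.symm hy))).ne'
  rw [Complex.div_im]
  field_simp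
  simp
  ring

/-- `Im z₄ · |x|² |1−y|² = Re x · Im y − Im x · Re y − |x|² · Im y + Im x · |y|²`, the
concyclicity determinant `det (|p|², Re p, Im p)_{p = 1, x, y}` of `(0, 1, x, y)` (vanishes iff the
four points are concyclic or collinear). Needs `x ≠ 0`, `y ∉ {0, 1}` (division junk otherwise).
[folklore] -/
theorem im_arg_four {x y : ℂ} (hx : x ≠ 0) (hy : y ≠ 0) (hy1 : y ≠ 1) :
    ((1 - x⁻¹) / (1 - y⁻¹)).im * (Complex.normSq x * Complex.normSq (1 - y)) =
      x.re * y.im - x.im * y.re - Complex.normSq x * y.im + x.im * Complex.normSq y := by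
  have e : (1 - x⁻¹) / (1 - y⁻¹) = (y * (1 - x)) / (x * (1 - y)) := by
    rw [arg_four_eq_mul hx hy hy1, div_mul_div_comm]
  rw [e, Complex.div_im, Complex.normSq_mul]
  have hN : Complex.normSq x ≠ 0 := (Complex.normSq_pos.mpr hx).ne'
  have hM : Complex.normSq (1 - y) ≠ 0 :=
    (Complex.normSq_pos.mpr (sub_ne_zero.mpr (Ne.symm hy1))).ne'
  field_simp
  simp [Complex.normSq_apply]
  ring


end Summit.KontsevichZagierPeriods.HyperbolicBloch.FiveTermTransferNegative
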